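import Literature.NumberTheory.PAdicHodge.TateAlmostEtaleCombinatorics
import Literature.NumberTheory.PAdicHodge.TateAlmostEtaleCyclotomicLayer
import HarnessLib

/-!
# Tate's almost étale lemma in a finite layer `Ω = E(ζ_{p^n})`: the gauge bound and the trace-one element

Assembly of `TateAlmostEtaleCombinatorics` (finite-group core), `TateAlmostEtaleGauge` (Serre IV §1
Prop. 3 as norm inequalities, Euler's trace-one element) and `TateAlmostEtaleCyclotomicLayer`
(`𝒪_{ℚ_p(ζ)} = ℤ_p[ζ]`, counting in `(ℤ/pⁿ)^×`).  Setting: `F` a `p`-adic field, `K₀ = PadicBase F p hp`,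
`F̄ = NormedAlgClosure F`, a finite normal layer `K₀ ⊆ Ω ⊆ F̄` with group `G = Gal(Ω/K₀)`, an integral
`x ∈ Ω` with trivial stabiliser GENERATING THE INTEGERS in the sense needed (`y₀ = P(x)`,
`P ∈ ℤ_p[X]`), an element `y₀ ∈ Ω` (think: a generator of a finite Galois `E/K₀`) with stabiliser `C`,
and `ζ ∈ Ω` a primitive `p^n`-th root of unity with stabiliser `H`, such that `H ∩ C = 1` (i.e.
`Ω = K₀(ζ, y₀) = E(ζ_{p^n})`).  The subgroups `H`, `C` are passed generically with their membership
characterisations (`hH`, `hC`).  Then: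

* `gauge_gt_of_layer` (**Tate's bound**, Tate 1967 §3.2, proof of Prop. 9; Serre IV §1 Prop. 3): if
  `‖p‖^{m−1} < J^D` where `J ≤ ‖σ y₀ − y₀‖` for all `σ` moving `y₀` and `D ≥ [G : C]` (both depend on
  `y₀` only, not on `n`), and `m + 1 ≤ n`, then EVERY `h ∈ H ∖ 1` moves `x` by more than
  `‖ζ_{p^{n−m}} − 1‖ = ‖p‖^{1/φ(p^{n−m})}` — the decay of the different of `Ω/K₀(ζ_{p^n})`;
* `norm_traceOneElt_mul_pow_le_one` (**the almost integral trace-one element**): the element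
  `y = x^{d−1}/∏_{h≠1}(x − hx)` (`d = |H|`), which has `Σ_{h ∈ H} h y = 1`
  (`sum_gal_traceOneElt_eq_one`), satisfies `‖y‖ · ‖ζ_{p^{n−m}} − 1‖^{d−1} ≤ 1`.

The remaining inputs — a generator `x` of `𝒪_Ω` over `ℤ_p` (Serre III §6 Prop. 12) and the passage
to the trace form of "deeply ramified" for `K_v K_∞^{cyc}` — are separate files.  No differents, no
Herbrand functions, no `sorry`, no definitions.

References: J. Tate, *p-divisible groups* (1967) §3.2 Prop. 9 [Tate1967]; J.-P. Serre, *Local Fields*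
Ch. IV §1 Prop. 3, Ch. III §6 [SerreLocalFields1979].
-/

noncomputable section

open scoped Classical
open Polynomial Finset IntermediateField

namespace Literature.NumberTheory.PAdicHodge.TateAlmostEtale

open ValuativeRel CyclotomicTower
open Literature.NumberTheory.GaloisRepresentations
open Literature.NumberTheory.GaloisRepresentations.IsNonarchimedeanLocalField

variable {F : Type} [Field F] [ValuativeRel F] [TopologicalSpace F] [IsNonarchimedeanLocalField F]
  [CharZero F] {p : ℕ} [Fact p.Prime] (hp : valuation F p < 1)
variable (Ω : IntermediateField (PadicBase F p hp) (NormedAlgClosure F))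
  [FiniteDimensional (PadicBase F p hp) Ω] [Normal (PadicBase F p hp) Ω]

omit [FiniteDimensional (PadicBase F p hp) Ω] [Normal (PadicBase F p hp) Ω] in
/-- `‖g (ζ − 1) − (ζ − 1)‖ = ‖g ζ − ζ‖`. [folklore] -/
private theorem norm_gal_sub_one_sub (ζΩ : Ω) (g : Ω ≃ₐ[PadicBase F p hp] Ω) :
    ‖((g (ζΩ - 1) : Ω) : NormedAlgClosure F) - ((ζΩ - 1 : Ω) : NormedAlgClosure F)‖ =
      ‖((g ζΩ : Ω) : NormedAlgClosure F) - ζΩ‖ := by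
  rw [map_sub, map_one]; push_cast; ring_nf

/-- The counting bound of `TateAlmostEtaleCyclotomicLayer` for a subgroup `H` given by its membership
characterisation `g ∈ H ↔ g ζ = ζ` (transport from `MulAction.stabilizer`).
[cite: SerreLocalFields1979, Ch. IV §4 Prop. 17–18] -/
theorem prod_erase_max_norm_sub_le' {n m : ℕ} (hm : 1 ≤ m) (hmn : m + 1 ≤ n) {ζΩ : Ω}
    (hζ : (ζΩ : NormedAlgClosure F) = zeta F p n) (H : Subgroup (Ω ≃ₐ[PadicBase F p hp] Ω))
    (hH : ∀ g, g ∈ H ↔ g ζΩ = ζΩ) :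
    ∏ q ∈ (Finset.univ : Finset ((Ω ≃ₐ[PadicBase F p hp] Ω) ⧸ H)).erase
          ((1 : Ω ≃ₐ[PadicBase F p hp] Ω) : (Ω ≃ₐ[PadicBase F p hp] Ω) ⧸ H),
        max ‖((q.out ζΩ : Ω) : NormedAlgClosure F) - ζΩ‖ ‖zeta F p (n - m) - 1‖ ≤
      ‖(p : PadicBase F p hp)‖ ^ (m - 1) := by
  have hHeq : H = MulAction.stabilizer (Ω ≃ₐ[PadicBase F p hp] Ω) ζΩ := by
    ext g; rw [hH g, MulAction.mem_stabilizer_iff]; rfl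
  subst hHeq
  convert prod_erase_max_norm_sub_le hp Ω hm hmn hζ using 3
  ext q; simp only [Finset.mem_univ]

/-- **Tate's bound in the layer `Ω = K₀(ζ_{p^n}, y₀)`** (Tate 1967 §3.2, the decay of
`𝔇(E(ζ_{p^n})/ℚ_p(ζ_{p^n}))`, via Serre IV §1 Prop. 3 — WITHOUT differents or Herbrand functions).
Let `x ∈ Ω` be integral with trivial stabiliser and `y₀ = P(x)`, `P ∈ ℤ_p[X]`; `C = Stab(y₀)`,
`ζ ∈ Ω` with `(ζ : F̄) = ζ_{p^n}` and `H = Stab(ζ)`, `H ∩ C = 1`; `0 ≤ J ≤ 1` a lower bound for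
`‖σ y₀ − y₀‖` over the `σ` moving `y₀`, `D ≥ [G : C]`, and `1 ≤ m`, `m + 1 ≤ n` with
`‖p‖^{m−1} < J^D`.  Then every `h ∈ H ∖ 1` satisfies `‖ζ_{p^{n−m}} − 1‖ < ‖h x − x‖`.
[cite: Tate1967, §3.2 Prop. 9 (proof)] [cite: SerreLocalFields1979, Ch. IV §1 Prop. 3] -/
theorem gauge_gt_of_layer {x : Ω} (hx : ‖(x : NormedAlgClosure F)‖ ≤ 1)
    (hfree : ∀ g : Ω ≃ₐ[PadicBase F p hp] Ω, g x = x → g = 1)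
    {y₀ : Ω} (P : (PadicBase F p hp)[X]) (hP : ∀ j, ‖P.coeff j‖ ≤ 1) (hPy : aeval x P = y₀)
    (C : Subgroup (Ω ≃ₐ[PadicBase F p hp] Ω)) (hC : ∀ g, g ∈ C ↔ g y₀ = y₀)
    {n : ℕ} {ζΩ : Ω} (hζ : (ζΩ : NormedAlgClosure F) = zeta F p n)
    (H : Subgroup (Ω ≃ₐ[PadicBase F p hp] Ω)) (hH : ∀ g, g ∈ H ↔ g ζΩ = ζΩ)
    (hHC : ∀ g : Ω ≃ₐ[PadicBase F p hp] Ω, g ζΩ = ζΩ → g y₀ = y₀ → g = 1)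
    {J : ℝ} (hJ0 : 0 ≤ J) (hJ1 : J ≤ 1)
    (hJ : ∀ σ : Ω ≃ₐ[PadicBase F p hp] Ω, σ y₀ ≠ y₀ →
      J ≤ ‖((σ y₀ : Ω) : NormedAlgClosure F) - y₀‖)
    {D : ℕ} (hD : Fintype.card ((Ω ≃ₐ[PadicBase F p hp] Ω) ⧸ C) ≤ D)
    {m : ℕ} (hm : 1 ≤ m) (hmn : m + 1 ≤ n)
    (hsmall : ‖(p : PadicBase F p hp)‖ ^ (m - 1) < J ^ D)
    {g₁ : Ω ≃ₐ[PadicBase F p hp] Ω} (hg₁H : g₁ ∈ H) (hg₁1 : g₁ ≠ 1) :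
    ‖zeta F p (n - m) - 1‖ < ‖((g₁ x : Ω) : NormedAlgClosure F) - x‖ := by
  set N : (Ω ≃ₐ[PadicBase F p hp] Ω) → ℝ := fun g => ‖((g x : Ω) : NormedAlgClosure F) - x‖
    with hNdef
  set U₀ : ℝ := ‖zeta F p (n - m) - 1‖ with hU₀
  have hn : 1 ≤ n := le_trans (by omega) hmn
  have hnn : ∀ g, 0 ≤ N g := fun g => norm_nonneg _
  have hle1 : ∀ g, N g ≤ 1 := fun g => gauge_le_one hp Ω g hx
  have hmul : ∀ g g' : Ω ≃ₐ[PadicBase F p hp] Ω, N (g * g') ≤ max (N g) (N g') :=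
    fun g g' => gauge_mul_le hp Ω g g' x
  have hinv : ∀ g : Ω ≃ₐ[PadicBase F p hp] Ω, N g⁻¹ = N g := fun g => gauge_inv hp Ω g x
  -- the `C`-side lower bound
  have hJ' : ∀ σ : Ω ≃ₐ[PadicBase F p hp] Ω, σ ∉ C → J ≤ ∏ τ : C, N (σ * τ) := by
    intro σ hσ
    have hσy : σ y₀ ≠ y₀ := fun e => hσ ((hC σ).mpr e)
    have h3 := norm_sub_le_prod_gauge hp Ω hx hfree P hP C
      (fun τ hτ => by rw [hPy]; exact (hC τ).mp hτ) σ
    rw [hPy] at h3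
    exact (hJ σ hσy).trans h3
  -- the `H`-side upper bound
  have hgen : ∀ c : Ω, (∀ g ∈ H, g c = c) → ‖(c : NormedAlgClosure F)‖ ≤ 1 →
      ∃ s : (PadicBase F p hp)[X], (∀ j, ‖s.coeff j‖ ≤ 1) ∧ aeval (ζΩ - 1) s = c :=
    fun c hc hc1 => exists_integral_aeval_eq_of_forall_stabilizer hp Ω hn hζ c
      (fun g hg => hc g ((hH g).mpr (MulAction.mem_stabilizer_iff.mp hg))) hc1
  have hζ1 : ‖((ζΩ - 1 : Ω) : NormedAlgClosure F)‖ ≤ 1 := by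
    push_cast; rw [hζ]; exact norm_zeta_sub_one_le_one n
  have hU₀0 : 0 ≤ U₀ := norm_nonneg _
  have hU₀1 : U₀ ≤ 1 := norm_zeta_sub_one_le_one _
  have hPG : ∏ g : Ω ≃ₐ[PadicBase F p hp] Ω, max (N g) U₀ ≤ ‖(p : PadicBase F p hp)‖ ^ (m - 1) := by
    refine (prod_max_univ_le_prod_quotient N hnn hle1 H hU₀0 hU₀1).trans ?_
    refine le_trans ?_ (prod_erase_max_norm_sub_le' hp Ω hm hmn hζ H hH)
    refine Finset.prod_le_prod (fun q _ => le_max_of_le_left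
      (Finset.prod_nonneg fun _ _ => hnn _)) (fun q _ => max_le_max_right _ ?_)
    have h4 := prod_gauge_le_norm_sub hp Ω hx H hζ1 hgen q.out
    rwa [norm_gal_sub_one_sub] at h4
  have hlt : ∏ g : Ω ≃ₐ[PadicBase F p hp] Ω, max (N g) U₀ <
      J ^ Fintype.card ((Ω ≃ₐ[PadicBase F p hp] Ω) ⧸ C) :=
    calc ∏ g : Ω ≃ₐ[PadicBase F p hp] Ω, max (N g) U₀ ≤ ‖(p : PadicBase F p hp)‖ ^ (m - 1) := hPG
      _ < J ^ D := hsmall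
      _ ≤ J ^ Fintype.card ((Ω ≃ₐ[PadicBase F p hp] Ω) ⧸ C) := pow_le_pow_of_le_one hJ0 hJ1 hD
  -- `g₁ ∉ C`
  have hg₁C : g₁ ∉ C := fun hC' => hg₁1 (hHC g₁ ((hH g₁).mp hg₁H) ((hC g₁).mp hC'))
  exact lt_apply_of_prod_max_univ_lt N hnn hmul hinv C hJ0 hJ' hlt hg₁C

/-- **The trace-one element is almost integral**: under the hypotheses of `gauge_gt_of_layer`,
`y = x^{d−1}/∏_{h' ≠ 1}(x − h'x)` (`d = |H|`, `H = Stab ζ`; `Σ_{h∈H} h y = 1` by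
`sum_gal_traceOneElt_eq_one`) satisfies `‖y‖ · ‖ζ_{p^{n−m}} − 1‖^{d−1} ≤ 1` (each
`‖h'x − x‖ > ‖ζ_{p^{n−m}} − 1‖`, and `‖x‖ ≤ 1`).  Tate 1967 §3.2: `Tr_{Ω/K₀(ζ)}(𝓞_Ω)` contains elements
of valuation `→ 0`. [cite: Tate1967, §3.2 Prop. 9 (proof)] -/
theorem norm_traceOneElt_mul_pow_le_one {x : Ω} (hx : ‖(x : NormedAlgClosure F)‖ ≤ 1)
    (hfree : ∀ g : Ω ≃ₐ[PadicBase F p hp] Ω, g x = x → g = 1)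
    {y₀ : Ω} (P : (PadicBase F p hp)[X]) (hP : ∀ j, ‖P.coeff j‖ ≤ 1) (hPy : aeval x P = y₀)
    (C : Subgroup (Ω ≃ₐ[PadicBase F p hp] Ω)) (hC : ∀ g, g ∈ C ↔ g y₀ = y₀)
    {n : ℕ} {ζΩ : Ω} (hζ : (ζΩ : NormedAlgClosure F) = zeta F p n)
    (H : Subgroup (Ω ≃ₐ[PadicBase F p hp] Ω)) (hH : ∀ g, g ∈ H ↔ g ζΩ = ζΩ)
    (hHC : ∀ g : Ω ≃ₐ[PadicBase F p hp] Ω, g ζΩ = ζΩ → g y₀ = y₀ → g = 1)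
    {J : ℝ} (hJ0 : 0 ≤ J) (hJ1 : J ≤ 1)
    (hJ : ∀ σ : Ω ≃ₐ[PadicBase F p hp] Ω, σ y₀ ≠ y₀ →
      J ≤ ‖((σ y₀ : Ω) : NormedAlgClosure F) - y₀‖)
    {D : ℕ} (hD : Fintype.card ((Ω ≃ₐ[PadicBase F p hp] Ω) ⧸ C) ≤ D)
    {m : ℕ} (hm : 1 ≤ m) (hmn : m + 1 ≤ n)
    (hsmall : ‖(p : PadicBase F p hp)‖ ^ (m - 1) < J ^ D) :
    ‖((x ^ (Fintype.card H - 1) /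
          ∏ h' ∈ (Finset.univ : Finset H).erase 1, (x - (h' : Ω ≃ₐ[PadicBase F p hp] Ω) x) : Ω) :
          NormedAlgClosure F)‖ *
        ‖zeta F p (n - m) - 1‖ ^ (Fintype.card H - 1) ≤ 1 := by
  set U₀ : ℝ := ‖zeta F p (n - m) - 1‖ with hU₀
  rw [norm_traceOneElt]
  have hcard : ((Finset.univ : Finset H).erase 1).card = Fintype.card H - 1 := by
    rw [Finset.card_erase_of_mem (Finset.mem_univ _), Finset.card_univ]
  have hU₀pos : 0 < U₀ := norm_zeta_sub_one_pos (by omega)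
  -- each factor of the denominator exceeds `U₀`
  have hden : U₀ ^ (Fintype.card H - 1) ≤
      ∏ h' ∈ (Finset.univ : Finset H).erase 1,
        ‖(((h' : Ω ≃ₐ[PadicBase F p hp] Ω) x : Ω) : NormedAlgClosure F) - x‖ := by
    rw [← hcard, ← Finset.prod_const]
    refine Finset.prod_le_prod (fun _ _ => hU₀pos.le) fun h' hh' => le_of_lt ?_
    have hh'1 : (h' : Ω ≃ₐ[PadicBase F p hp] Ω) ≠ 1 := by
      intro e; exact (Finset.mem_erase.mp hh').1 (Subtype.ext e)
    exact gauge_gt_of_layer hp Ω hx hfree P hP hPy C hC hζ H hH hHC hJ0 hJ1 hJ hD hm hmn hsmall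
      h'.2 hh'1
  have hden_pos : 0 < ∏ h' ∈ (Finset.univ : Finset H).erase 1,
      ‖(((h' : Ω ≃ₐ[PadicBase F p hp] Ω) x : Ω) : NormedAlgClosure F) - x‖ :=
    lt_of_lt_of_le (pow_pos hU₀pos _) hden
  rw [div_mul_eq_mul_div, div_le_one hden_pos]
  calc ‖(x : NormedAlgClosure F)‖ ^ (Fintype.card H - 1) * U₀ ^ (Fintype.card H - 1)
      ≤ 1 * U₀ ^ (Fintype.card H - 1) := by
        gcongr; exact pow_le_one₀ (norm_nonneg _) hx
    _ ≤ _ := by rw [one_mul]; exact hden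

end Literature.NumberTheory.PAdicHodge.TateAlmostEtale

end
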